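import Summits.CriticalPhenomena.PercolationContinuityZ3.Theorems.PercNearOneGluingAdditiveGluingCSHSetDefs
import HarnessLib

/-!
# Conjecture G / SET-W via a SET observer, XXI: a priori bounds on the level forms and the constants of the set hierarchy

Support file (`--supports stmt-CriticalPhenomena-4576`); no definitions, no named facts, no sorries.  Seat (b) V⁺-form `png-dp-vplus`, gen 13
(memo MEMO-gen13.md §3; input of the ROBUST Theorem 2-set `…SetObserverPreMarginApprox.lean`).
* `abs_slForm_le`, `abs_cshMarg_le` — `|sl_L[f]| ≤ 2^{|L|}·B` and `|Marg[f]| ≤ (1+|p|)·2^{|L|}·B` when `|f| ≤ B` and the constants of `L` lie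
  in `[0,1]`;
* `decoyListSet_consts_mem`, `length_decoyListSet` — the constants of `CSHSet.decoyListSet` are conditional probabilities in `[0,1]`, one per decoy.
[cite: VandenbergHaggstromKahn2005, Thm. 1.3 (p. 6)] [cite: KozmaNitzan2024, Conj. 4 (p. 32)]
-/

noncomputable section

namespace Summit.CriticalPhenomena.PercolationContinuityZ3.Theorems

open MeasureTheory Set Literature.Probability.LatticeModels Literature.Probability.Percolation
open scoped Classical

namespace CSHSet

open CSH

/-! ### A priori bounds on the level forms -/

/-- `|sl_L[f](s)| ≤ 2^{|L|}·B` when `|f| ≤ B` and all constants of `L` lie in `[0,1]`. [folklore] -/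
theorem abs_slForm_le {W : Type*} (L : List (W × (W → ℝ))) (hL : ∀ dc ∈ L, ∀ s, 0 ≤ dc.2 s ∧ dc.2 s ≤ 1) :
    ∀ (f : W → ℝ) (B : ℝ), (∀ s, |f s| ≤ B) → ∀ s, |slForm L f s| ≤ 2 ^ L.length * B := by
  induction L with
  | nil => intro f B hf s; simpa using hf s
  | cons dc L ih =>
    intro f B hf s
    rw [slForm_cons_eq, List.length_cons, pow_succ]
    have hstep : ∀ s', |slStep dc f s'| ≤ 2 * B := by
      intro s'
      simp only [slStep]
      have h1 := hf s'
      have h2 := hf dc.1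
      have hc := (hL dc List.mem_cons_self) s'
      have h3 : |dc.2 s' * f dc.1| ≤ B := by
        rw [abs_mul, abs_of_nonneg hc.1]
        calc dc.2 s' * |f dc.1| ≤ 1 * |f dc.1| := mul_le_mul_of_nonneg_right hc.2 (abs_nonneg _)
          _ ≤ B := by rw [one_mul]; exact h2
      calc |f s' - dc.2 s' * f dc.1| ≤ |f s'| + |dc.2 s' * f dc.1| := abs_sub _ _
        _ ≤ 2 * B := by linarith
    have := ih (fun dc' hdc' => hL dc' (List.mem_cons_of_mem _ hdc')) (slStep dc f) (2 * B) hstep s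
    linarith [this]

/-- `|Marg[f]| ≤ (1 + |p|)·2^{|L|}·B` when `|f| ≤ B` and all constants of `L` lie in `[0,1]`. [folklore] -/
theorem abs_cshMarg_le {W : Type*} (L : List (W × (W → ℝ))) (hL : ∀ dc ∈ L, ∀ s, 0 ≤ dc.2 s ∧ dc.2 s ≤ 1) (p : ℝ) (o v : W)
    (f : W → ℝ) (B : ℝ) (hf : ∀ s, |f s| ≤ B) : |cshMarg L p o v f| ≤ (1 + |p|) * 2 ^ L.length * B := by
  unfold cshMarg
  have ho := abs_slForm_le L hL f B hf o
  have hv := abs_slForm_le L hL f B hf v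
  calc |slForm L f o - p * slForm L f v| ≤ |slForm L f o| + |p * slForm L f v| := abs_sub _ _
    _ = |slForm L f o| + |p| * |slForm L f v| := by rw [abs_mul]
    _ ≤ 2 ^ L.length * B + |p| * (2 ^ L.length * B) := by
        have := mul_le_mul_of_nonneg_left hv (abs_nonneg p); linarith
    _ = (1 + |p|) * 2 ^ L.length * B := by ring

variable {n : ℕ}

/-- The constants of `decoyListSet w O A D` are conditional probabilities, hence in `[0,1]`. [folklore] -/
theorem decoyListSet_consts_mem (w : Sym2 (Fin n) → unitInterval) (O : Finset (Fin n)) :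
    ∀ (A : Set (Fin n)) (D : List (Fin n)), ∀ dc ∈ decoyListSet w O A D, ∀ s, 0 ≤ dc.2 s ∧ dc.2 s ≤ 1
  | A, [] => by simp
  | A, d :: ds => by
    intro dc hdc s
    rw [decoyListSet_cons, List.mem_cons] at hdc
    rcases hdc with rfl | hdc
    · refine ⟨by simp only [avoidConstSet]; positivity, ?_⟩
      simp only [avoidConstSet]
      exact div_le_one_of_le₀ (measureReal_mono inter_subset_left (measure_ne_top _ _)) measureReal_nonneg
    · exact decoyListSet_consts_mem w O (insert d A) ds dc hdc s

/-- `decoyListSet w O A D` has one entry per decoy. [folklore] -/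
theorem length_decoyListSet (w : Sym2 (Fin n) → unitInterval) (O : Finset (Fin n)) :
    ∀ (A : Set (Fin n)) (D : List (Fin n)), (decoyListSet w O A D).length = D.length
  | A, [] => rfl
  | A, d :: ds => by rw [decoyListSet_cons, List.length_cons, List.length_cons, length_decoyListSet w O (insert d A) ds]

end CSHSet

end Summit.CriticalPhenomena.PercolationContinuityZ3.Theorems

end
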